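import Summits.Ventures.CertifiedManyBodySolver.Rows.SourcedTorusRowsBridge
import Literature.MathematicalPhysics.QuantumLattice.DWaveSourceNNNHoppingWindowCertificateKKTEnergy
import HarnessLib

/-!
# PINNING-FIELD rows: window certificates WITH KKT (ground-state) rows instantiate the ground-state cells and
# the energy floor cell

HONEST FRAMING: first certified bounds on pairing observables; not a superconductivity verdict; every
number certified (two lineages + referee) or labelled float. A response AT FIXED `h > 0` is
symmetry-allowed and says nothing about spontaneous order.

WHAT THIS FILE IS (cell hubbard-cq, D-0082 (c) / LADDER row PC-a, seat hubbard-cq-obsth-1 "pinning-field K5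
menu nodes"; sequel of `Rows/SourcedTorusRowsWindowHook.lean`). The tree soundness theorems WITH a
state-optimality block (`Literature/…/DWaveSourceNNNHoppingWindowCertificateKKT[Energy].lean`:
`re_orbitState_ge_of_sourced_window_certificate_d4_TT'_kkt[_of_energy_le]`,
`dWaveSourceTorusTT'_groundEnergy_ge_of_window_certificate_d4_kkt[_eventually]`) read ONE window identity

  `X − c·1 [− κ (u·1 − E^{src,tt'})] = SOS + Σ[H^{src,tt'}_{Λ'}, Γ(incl)Bₖ] + Σ(affine-D₄ defects) + Σ bⱼ wⱼ
   + Σ dₘ(Vₘᴴ − Vₘ) + Σ aₖ vₖ + kktForm H^{src,tt'}_{Λ'} G (Γ(incl) ∘ B)`      (`G ⪰ 0`, `B_b ∈ 𝔄_Λ` ARBITRARY)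

in the orbit state of every `S^z`-eigenvector GROUND vector of the pair-sourced `t–t'` torus
`A_L = dWaveSourceTorusTT' L tp U μ h` (the ground state of the sourced problem lives on the full Fock space, so
charged / odd generators are admissible — card `sourced-kkt-one-point-floor`). This file turns them into cells:

* §1 one torus: `SourcedTorusCorrLowerRowGS.of_window_certificate_kkt` (identity WITHOUT cap row ⇒ ground-state
  LOWER cell for `r ≤ c − Σₖ ‖aₖ‖`), `…_kkt_of_energyUpperRow` (identity with `κ (u·1 − E^{src,tt'})`, `κ ≥ 0`,
  plus the energy CEILING cell at `u`), `SourcedTorusEnergyLowerRow.of_window_certificate_kkt` (ENERGY identity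
  with KKT block ⇒ energy FLOOR cell `e ≤ c − Σₖ ‖aₖ‖`, the sourced `e_lo(h)` row of the Hellmann–Feynman chords).
* §2 uniform: the same from ONE identity on every large torus (`∃ L₀`, `x ↦ x mod L` eventually injective):
  `SourcedCorrLowerRowGS.of_window_certificate_kkt[_of_energyUpperRow]`, `SourcedEnergyLowerRow.of_window_certificate_kkt`.
The one-point word under affine `D₄` labels and the end-to-end response leaves are in
`Rows/SourcedTorusRowsOnePointKKT.lean`.

NOTHING IS ASSERTED: identities in, cells out; no certificate, no number, no `sorry`, no named fact.
Elaborated under the torus files' local `DecidableEq (FermionTorus 2 L)` instance (cells met literally).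

References: T. Koma, H. Tasaki, J. Stat. Phys. 76 (1994) 745, §1; M. Araújo et al., arXiv:2311.18707 §3.2
Prop. 11; O. Bratteli, D. W. Robinson II Prop. 5.3.19; J. Wang et al., PRX 14 (2024) 031006, §III;
X. Han, arXiv:2006.06002 §3.
-/

noncomputable section

namespace Summit.Ventures.CertifiedManyBodySolver

open Literature.MathematicalPhysics.QuantumLattice
open Matrix HubbardWave0 Literature.Probability.LatticeModels Finset
open Literature.MathematicalPhysics.QuantumManyBody.StateRelaxation
open scoped BigOperators ComplexOrder

/-- (Local to this file, as in `Rows/SourcedTorusRows[Hook]`.) -/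
local instance (priority := high) instDecidableEqFermionTorusSourcedKKTHook {L : ℕ} :
    DecidableEq (FermionTorus 2 L) :=
  LinearOrder.toDecidableEq

/-! ## §1  One torus: KKT window identities ⇒ ground-state cells and the energy floor cell -/

section OneTorus

variable {L : ℕ} [NeZero L]

/-- **KKT window identity (no cap row) ⇒ the ground-state LOWER cell.** The identity of
`re_orbitState_ge_of_sourced_window_certificate_d4_TT'_kkt` for the objective `Xw` — SOS, commutators with
`H^{src,tt'}_{Λ'}`, affine-`D₄` defects (`γₗ ∈ S`), `S^z`-charged words, anti-Hermitian parts, residual words and a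
KKT block `kktForm H^{src,tt'}_{Λ'} G (Γ(incl) ∘ B)` with `G ⪰ 0` and ARBITRARY `B_b ∈ 𝔄_Λ` — and a rational
slot `r ≤ c − Σₖ ‖aₖ‖` give `SourcedTorusCorrLowerRowGS L tp U μ h r Λ' hInj' S Xw` on every torus `L ≥ 3` into
which `thicken Λ' 1` fits. -/
theorem SourcedTorusCorrLowerRowGS.of_window_certificate_kkt (tp U μ h : ℝ) (hL : 3 ≤ L) {r : ℚ}
    {Λ Λ' : Finset (Site 2)} (hΛ : Λ ⊆ Λ') (h8 : thicken Λ 1 ⊆ Λ')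
    (h0 : thicken ({0} : Finset (Site 2)) 1 ⊆ Λ') (hz : (0 : Site 2) ∈ Λ')
    (hP : pairRegion (insert (0 : Site 2) unitSteps) 0 ⊆ Λ')
    (hInj : Set.InjOn (Torus.proj (d := 2) L) ↑(thicken Λ' 1))
    (hInj' : Set.InjOn (Torus.proj (d := 2) L) ↑Λ')
    {S : Finset (DihedralGroup 4)} (h1 : (1 : DihedralGroup 4) ∈ S) (hmul : ∀ a ∈ S, ∀ b ∈ S, a * b ∈ S)
    (hS : ∀ γ ∈ S, b1gChar γ = 1) (Xw : FermionOp Λ')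
    {m : Type*} [Fintype m] [DecidableEq m] {Λm : Matrix m m ℂ} (hΛm : Λm.PosSemidef)
    (O : m → FermionOp Λ')
    {κ' : Type*} (s : Finset κ') (B : κ' → FermionOp Λ)
    {ι : Type*} (tt : Finset ι) (γ : ι → DihedralGroup 4) (hγS : ∀ l ∈ tt, γ l ∈ S) (wv : ι → Site 2)
    (hsh : ∀ l, d4ShiftSet (γ l) (wv l) Λ ⊆ Λ') (Y : ι → FermionOp Λ)
    {ρ : Type*} (uu : Finset ρ) (b : ρ → ℂ) (cw : ρ → List (Orb (PolySite Λ') × Bool))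
    (hcw : ∀ j ∈ uu, ladderSpinCharge (cw j) ≠ 0)
    {δ : Type*} (ah : Finset δ) (dc : δ → ℝ) (V : δ → FermionOp Λ')
    {κ'' : Type*} (w : Finset κ'') (a : κ'' → ℂ) (word : κ'' → List (Orb (PolySite Λ') × Bool))
    {β : Type*} [Fintype β] [DecidableEq β] {G : Matrix β β ℂ} (hG : G.PosSemidef)
    (Bk : β → FermionOp Λ) {c : ℝ}
    (hcert : Xw - (c : ℂ) • (1 : FermionOp Λ') =
      gramForm Λm O +
        (∑ k ∈ s, (pairSourceWindowHamiltonianTT' dWaveFormFactor Λ' tp U μ h * fermionEmbed (PolySite.incl hΛ) (B k) -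
            fermionEmbed (PolySite.incl hΛ) (B k) * pairSourceWindowHamiltonianTT' dWaveFormFactor Λ' tp U μ h) +
          ∑ l ∈ tt, (fermionEmbed (PolySite.incl (hsh l)) (fermionEmbed (PolySite.d4Emb (γ l) (wv l) Λ) (Y l)) -
            fermionEmbed (PolySite.incl hΛ) (Y l)) +
          ∑ j ∈ uu, b j • ladderWord (cw j)) +
        (∑ m' ∈ ah, ((dc m' : ℝ) : ℂ) • ((V m')ᴴ - V m') + ∑ k ∈ w, a k • ladderWord (word k)) +
        kktForm (pairSourceWindowHamiltonianTT' dWaveFormFactor Λ' tp U μ h) G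
          (fun b' => fermionEmbed (PolySite.incl hΛ) (Bk b')))
    (hr : ((r : ℚ) : ℝ) ≤ c - ∑ k ∈ w, ‖a k‖) :
    SourcedTorusCorrLowerRowGS L tp U μ h r Λ' hInj' S Xw := by
  intro M ψ hψK hψ1 hgs
  exact hr.trans (re_orbitState_ge_of_sourced_window_certificate_d4_TT'_kkt tp U μ h hL hΛ h8 h0 hz hP hInj hInj'
    h1 hmul hS hψK hψ1 hgs.2 Xw hΛm O s B tt γ hγS wv hsh Y uu b cw hcw ah dc V w a word hG Bk hcert)

/-- **KKT window identity with an energy constraint ⇒ the ground-state LOWER cell, given the energy CEILING cell.**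
The identity of `re_orbitState_ge_of_sourced_window_certificate_d4_TT'_kkt_of_energy_le` (energy constraint
`κ (u·1 − E^{src,tt'})`, `κ ≥ 0`, rational cap `u`) together with `SourcedTorusEnergyUpperRow L tp U μ h u`
(`E₀(A_L) ≤ u·L²`, a trial-state row) gives the ground-state cell at every `r ≤ c − Σₖ ‖aₖ‖`. -/
theorem SourcedTorusCorrLowerRowGS.of_window_certificate_kkt_of_energyUpperRow (tp U μ h : ℝ) (hL : 3 ≤ L)
    {u r : ℚ} (hE : SourcedTorusEnergyUpperRow L tp U μ h u)
    {Λ Λ' : Finset (Site 2)} (hΛ : Λ ⊆ Λ') (h8 : thicken Λ 1 ⊆ Λ')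
    (h0 : thicken ({0} : Finset (Site 2)) 1 ⊆ Λ') (hz : (0 : Site 2) ∈ Λ')
    (hP : pairRegion (insert (0 : Site 2) unitSteps) 0 ⊆ Λ')
    (hInj : Set.InjOn (Torus.proj (d := 2) L) ↑(thicken Λ' 1))
    (hInj' : Set.InjOn (Torus.proj (d := 2) L) ↑Λ')
    {S : Finset (DihedralGroup 4)} (h1 : (1 : DihedralGroup 4) ∈ S) (hmul : ∀ a ∈ S, ∀ b ∈ S, a * b ∈ S)
    (hS : ∀ γ ∈ S, b1gChar γ = 1) (Xw : FermionOp Λ') {κ : ℝ} (hκ : 0 ≤ κ)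
    {m : Type*} [Fintype m] [DecidableEq m] {Λm : Matrix m m ℂ} (hΛm : Λm.PosSemidef)
    (O : m → FermionOp Λ')
    {κ' : Type*} (s : Finset κ') (B : κ' → FermionOp Λ)
    {ι : Type*} (tt : Finset ι) (γ : ι → DihedralGroup 4) (hγS : ∀ l ∈ tt, γ l ∈ S) (wv : ι → Site 2)
    (hsh : ∀ l, d4ShiftSet (γ l) (wv l) Λ ⊆ Λ') (Y : ι → FermionOp Λ)
    {ρ : Type*} (uu : Finset ρ) (b : ρ → ℂ) (cw : ρ → List (Orb (PolySite Λ') × Bool))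
    (hcw : ∀ j ∈ uu, ladderSpinCharge (cw j) ≠ 0)
    {δ : Type*} (ah : Finset δ) (dc : δ → ℝ) (V : δ → FermionOp Λ')
    {κ'' : Type*} (w : Finset κ'') (a : κ'' → ℂ) (word : κ'' → List (Orb (PolySite Λ') × Bool))
    {β : Type*} [Fintype β] [DecidableEq β] {G : Matrix β β ℂ} (hG : G.PosSemidef)
    (Bk : β → FermionOp Λ) {c : ℝ}
    (hcert : Xw - (c : ℂ) • (1 : FermionOp Λ') -
        ((κ : ℝ) : ℂ) • ((((u : ℚ) : ℝ) : ℂ) • (1 : FermionOp Λ') -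
          (fermionEmbed (PolySite.incl h0) ((hubbardTTPrimeFermionInteraction 1 tp U).meanEnergyObs 1) -
            (μ : ℂ) • ∑ σ : Fin 2, nAt 0 hz σ -
            (h : ℂ) • (fermionEmbed (PolySite.incl hP) (localPairAt (insert (0 : Site 2) unitSteps) dWaveFormFactor 0) +
              (fermionEmbed (PolySite.incl hP) (localPairAt (insert (0 : Site 2) unitSteps) dWaveFormFactor 0))ᴴ))) =
      gramForm Λm O +
        (∑ k ∈ s, (pairSourceWindowHamiltonianTT' dWaveFormFactor Λ' tp U μ h * fermionEmbed (PolySite.incl hΛ) (B k) -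
            fermionEmbed (PolySite.incl hΛ) (B k) * pairSourceWindowHamiltonianTT' dWaveFormFactor Λ' tp U μ h) +
          ∑ l ∈ tt, (fermionEmbed (PolySite.incl (hsh l)) (fermionEmbed (PolySite.d4Emb (γ l) (wv l) Λ) (Y l)) -
            fermionEmbed (PolySite.incl hΛ) (Y l)) +
          ∑ j ∈ uu, b j • ladderWord (cw j)) +
        (∑ m' ∈ ah, ((dc m' : ℝ) : ℂ) • ((V m')ᴴ - V m') + ∑ k ∈ w, a k • ladderWord (word k)) +
        kktForm (pairSourceWindowHamiltonianTT' dWaveFormFactor Λ' tp U μ h) G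
          (fun b' => fermionEmbed (PolySite.incl hΛ) (Bk b')))
    (hr : ((r : ℚ) : ℝ) ≤ c - ∑ k ∈ w, ‖a k‖) :
    SourcedTorusCorrLowerRowGS L tp U μ h r Λ' hInj' S Xw := by
  intro M ψ hψK hψ1 hgs
  have hLsq : (0 : ℝ) < (L : ℝ) ^ 2 := by
    have : (0 : ℝ) < (L : ℝ) := by exact_mod_cast Nat.pos_of_ne_zero (NeZero.ne L)
    positivity
  have hu : (dWaveSourceTorusTT' L tp U μ h).groundEnergy / (L : ℝ) ^ 2 ≤ ((u : ℚ) : ℝ) := by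
    rw [div_le_iff₀ hLsq]
    exact hE
  exact hr.trans (re_orbitState_ge_of_sourced_window_certificate_d4_TT'_kkt_of_energy_le tp U μ h hL hΛ h8 h0 hz
    hP hInj hInj' h1 hmul hS hψK hψ1 hgs.2 Xw hκ hu hΛm O s B tt γ hγS wv hsh Y uu b cw hcw ah dc V w a word hG
    Bk hcert)

/-- **ENERGY window identity with a KKT block ⇒ the energy FLOOR cell on one torus**:
`dWaveSourceTorusTT'_groundEnergy_ge_of_window_certificate_d4_kkt` and a rational slot `e ≤ c − Σₖ ‖aₖ‖` give
`SourcedTorusEnergyLowerRow L tp U μ h e` (`e·L² ≤ E₀(A_L)`) for every `L ≥ 3` into which `thicken Λ' 1` fits —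
the sourced `e_lo(h)` row with ground-state rows admitted. -/
theorem SourcedTorusEnergyLowerRow.of_window_certificate_kkt (tp U μ h : ℝ) (hL : 3 ≤ L) {e : ℚ}
    {Λ Λ' : Finset (Site 2)} (hΛ : Λ ⊆ Λ') (h8 : thicken Λ 1 ⊆ Λ')
    (h0 : thicken ({0} : Finset (Site 2)) 1 ⊆ Λ') (hz : (0 : Site 2) ∈ Λ')
    (hP : pairRegion (insert (0 : Site 2) unitSteps) 0 ⊆ Λ')
    (hInj : Set.InjOn (Torus.proj (d := 2) L) ↑(thicken Λ' 1))
    {m : Type*} [Fintype m] [DecidableEq m] {Λm : Matrix m m ℂ} (hΛm : Λm.PosSemidef)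
    (O : m → FermionOp Λ')
    {κ : Type*} (s : Finset κ) (B : κ → FermionOp Λ)
    {ι : Type*} (tt : Finset ι) (gam : ι → DihedralGroup 4) (v : ι → Site 2)
    (hgam : ∀ l ∈ tt, b1gChar (gam l) = 1) (hsh : ∀ l, d4ShiftSet (gam l) (v l) Λ ⊆ Λ') (Y : ι → FermionOp Λ)
    {χ : Type*} (u : Finset χ) (b : χ → ℂ) (cw : χ → List (Orb (PolySite Λ') × Bool))
    (hcw : ∀ j ∈ u, ladderSpinCharge (cw j) ≠ 0)
    {δ : Type*} (ah : Finset δ) (dc : δ → ℝ) (V : δ → FermionOp Λ')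
    {κ'' : Type*} (w : Finset κ'') (a : κ'' → ℂ) (word : κ'' → List (Orb (PolySite Λ') × Bool))
    {β : Type*} [Fintype β] [DecidableEq β] {G : Matrix β β ℂ} (hG : G.PosSemidef)
    (Bk : β → FermionOp Λ) {c : ℝ}
    (hcert : fermionEmbed (PolySite.incl h0) ((hubbardTTPrimeFermionInteraction 1 tp U).meanEnergyObs 1) -
          (μ : ℂ) • ∑ σ : Fin 2, nAt 0 hz σ -
          (h : ℂ) • (fermionEmbed (PolySite.incl hP) (localPairAt (insert (0 : Site 2) unitSteps) dWaveFormFactor 0) +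
            (fermionEmbed (PolySite.incl hP) (localPairAt (insert (0 : Site 2) unitSteps) dWaveFormFactor 0))ᴴ) -
        (c : ℂ) • (1 : FermionOp Λ') =
      gramForm Λm O +
        (∑ k ∈ s, (pairSourceWindowHamiltonianTT' dWaveFormFactor Λ' tp U μ h * fermionEmbed (PolySite.incl hΛ) (B k) -
            fermionEmbed (PolySite.incl hΛ) (B k) * pairSourceWindowHamiltonianTT' dWaveFormFactor Λ' tp U μ h) +
          ∑ l ∈ tt, (fermionEmbed (PolySite.incl (hsh l)) (fermionEmbed (PolySite.d4Emb (gam l) (v l) Λ) (Y l)) -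
            fermionEmbed (PolySite.incl hΛ) (Y l)) +
          ∑ j ∈ u, b j • ladderWord (cw j)) +
        (∑ m' ∈ ah, ((dc m' : ℝ) : ℂ) • ((V m')ᴴ - V m') + ∑ k ∈ w, a k • ladderWord (word k)) +
        kktForm (pairSourceWindowHamiltonianTT' dWaveFormFactor Λ' tp U μ h) G
          (fun b' => fermionEmbed (PolySite.incl hΛ) (Bk b')))
    (he : ((e : ℚ) : ℝ) ≤ c - ∑ k ∈ w, ‖a k‖) :
    SourcedTorusEnergyLowerRow L tp U μ h e := by
  have hLsq : (0 : ℝ) ≤ (L : ℝ) ^ 2 := by positivity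
  have hmain := dWaveSourceTorusTT'_groundEnergy_ge_of_window_certificate_d4_kkt tp U μ h hL hΛ h8 h0 hz hP hInj
    hΛm O s B tt gam v hgam hsh Y u b cw hcw ah dc V w a word hG Bk hcert
  exact (mul_le_mul_of_nonneg_right he hLsq).trans hmain

end OneTorus

/-! ## §2  Uniform in `L`: one KKT identity ⇒ the uniform cells -/

section Uniform

/-- **KKT window identity (no cap row) ⇒ the uniform ground-state LOWER cell** `∃ L₀, SourcedCorrLowerRowGS tp U μ h
q L₀ r Λ' S Xw` (`L₀ = max 3 L₁`, `L₁` from `exists_forall_le_injOn_proj (thicken Λ' 1)`; every side progression `q`). -/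
theorem SourcedCorrLowerRowGS.of_window_certificate_kkt (tp U μ h : ℝ) {r : ℚ} (q : ℕ)
    {Λ Λ' : Finset (Site 2)} (hΛ : Λ ⊆ Λ') (h8 : thicken Λ 1 ⊆ Λ')
    (h0 : thicken ({0} : Finset (Site 2)) 1 ⊆ Λ') (hz : (0 : Site 2) ∈ Λ')
    (hP : pairRegion (insert (0 : Site 2) unitSteps) 0 ⊆ Λ')
    {S : Finset (DihedralGroup 4)} (h1 : (1 : DihedralGroup 4) ∈ S) (hmul : ∀ a ∈ S, ∀ b ∈ S, a * b ∈ S)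
    (hS : ∀ γ ∈ S, b1gChar γ = 1) (Xw : FermionOp Λ')
    {m : Type*} [Fintype m] [DecidableEq m] {Λm : Matrix m m ℂ} (hΛm : Λm.PosSemidef)
    (O : m → FermionOp Λ')
    {κ' : Type*} (s : Finset κ') (B : κ' → FermionOp Λ)
    {ι : Type*} (tt : Finset ι) (γ : ι → DihedralGroup 4) (hγS : ∀ l ∈ tt, γ l ∈ S) (wv : ι → Site 2)
    (hsh : ∀ l, d4ShiftSet (γ l) (wv l) Λ ⊆ Λ') (Y : ι → FermionOp Λ)
    {ρ : Type*} (uu : Finset ρ) (b : ρ → ℂ) (cw : ρ → List (Orb (PolySite Λ') × Bool))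
    (hcw : ∀ j ∈ uu, ladderSpinCharge (cw j) ≠ 0)
    {δ : Type*} (ah : Finset δ) (dc : δ → ℝ) (V : δ → FermionOp Λ')
    {κ'' : Type*} (w : Finset κ'') (a : κ'' → ℂ) (word : κ'' → List (Orb (PolySite Λ') × Bool))
    {β : Type*} [Fintype β] [DecidableEq β] {G : Matrix β β ℂ} (hG : G.PosSemidef)
    (Bk : β → FermionOp Λ) {c : ℝ}
    (hcert : Xw - (c : ℂ) • (1 : FermionOp Λ') =
      gramForm Λm O +
        (∑ k ∈ s, (pairSourceWindowHamiltonianTT' dWaveFormFactor Λ' tp U μ h * fermionEmbed (PolySite.incl hΛ) (B k) -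
            fermionEmbed (PolySite.incl hΛ) (B k) * pairSourceWindowHamiltonianTT' dWaveFormFactor Λ' tp U μ h) +
          ∑ l ∈ tt, (fermionEmbed (PolySite.incl (hsh l)) (fermionEmbed (PolySite.d4Emb (γ l) (wv l) Λ) (Y l)) -
            fermionEmbed (PolySite.incl hΛ) (Y l)) +
          ∑ j ∈ uu, b j • ladderWord (cw j)) +
        (∑ m' ∈ ah, ((dc m' : ℝ) : ℂ) • ((V m')ᴴ - V m') + ∑ k ∈ w, a k • ladderWord (word k)) +
        kktForm (pairSourceWindowHamiltonianTT' dWaveFormFactor Λ' tp U μ h) G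
          (fun b' => fermionEmbed (PolySite.incl hΛ) (Bk b')))
    (hr : ((r : ℚ) : ℝ) ≤ c - ∑ k ∈ w, ‖a k‖) :
    ∃ L₀ : ℕ, SourcedCorrLowerRowGS tp U μ h q L₀ r Λ' S Xw := by
  obtain ⟨L₁, hL₁⟩ := exists_forall_le_injOn_proj (thicken Λ' 1)
  refine ⟨max 3 L₁, fun L _ hInj' hL _ => ?_⟩
  exact SourcedTorusCorrLowerRowGS.of_window_certificate_kkt tp U μ h (le_trans (le_max_left _ _) hL) hΛ h8 h0 hz hP
    (hL₁ L (le_trans (le_max_right _ _) hL)) hInj' h1 hmul hS Xw hΛm O s B tt γ hγS wv hsh Y uu b cw hcw ah dc V w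
    a word hG Bk hcert hr

/-- **KKT window identity with an energy constraint + the uniform energy CEILING cell at the same cap ⇒ the uniform
ground-state LOWER cell** on the common sides. -/
theorem SourcedCorrLowerRowGS.of_window_certificate_kkt_of_energyUpperRow (tp U μ h : ℝ) {u r : ℚ} {q L₀' : ℕ}
    (hE : SourcedEnergyUpperRow tp U μ h q L₀' u)
    {Λ Λ' : Finset (Site 2)} (hΛ : Λ ⊆ Λ') (h8 : thicken Λ 1 ⊆ Λ')
    (h0 : thicken ({0} : Finset (Site 2)) 1 ⊆ Λ') (hz : (0 : Site 2) ∈ Λ')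
    (hP : pairRegion (insert (0 : Site 2) unitSteps) 0 ⊆ Λ')
    {S : Finset (DihedralGroup 4)} (h1 : (1 : DihedralGroup 4) ∈ S) (hmul : ∀ a ∈ S, ∀ b ∈ S, a * b ∈ S)
    (hS : ∀ γ ∈ S, b1gChar γ = 1) (Xw : FermionOp Λ') {κ : ℝ} (hκ : 0 ≤ κ)
    {m : Type*} [Fintype m] [DecidableEq m] {Λm : Matrix m m ℂ} (hΛm : Λm.PosSemidef)
    (O : m → FermionOp Λ')
    {κ' : Type*} (s : Finset κ') (B : κ' → FermionOp Λ)
    {ι : Type*} (tt : Finset ι) (γ : ι → DihedralGroup 4) (hγS : ∀ l ∈ tt, γ l ∈ S) (wv : ι → Site 2)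
    (hsh : ∀ l, d4ShiftSet (γ l) (wv l) Λ ⊆ Λ') (Y : ι → FermionOp Λ)
    {ρ : Type*} (uu : Finset ρ) (b : ρ → ℂ) (cw : ρ → List (Orb (PolySite Λ') × Bool))
    (hcw : ∀ j ∈ uu, ladderSpinCharge (cw j) ≠ 0)
    {δ : Type*} (ah : Finset δ) (dc : δ → ℝ) (V : δ → FermionOp Λ')
    {κ'' : Type*} (w : Finset κ'') (a : κ'' → ℂ) (word : κ'' → List (Orb (PolySite Λ') × Bool))
    {β : Type*} [Fintype β] [DecidableEq β] {G : Matrix β β ℂ} (hG : G.PosSemidef)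
    (Bk : β → FermionOp Λ) {c : ℝ}
    (hcert : Xw - (c : ℂ) • (1 : FermionOp Λ') -
        ((κ : ℝ) : ℂ) • ((((u : ℚ) : ℝ) : ℂ) • (1 : FermionOp Λ') -
          (fermionEmbed (PolySite.incl h0) ((hubbardTTPrimeFermionInteraction 1 tp U).meanEnergyObs 1) -
            (μ : ℂ) • ∑ σ : Fin 2, nAt 0 hz σ -
            (h : ℂ) • (fermionEmbed (PolySite.incl hP) (localPairAt (insert (0 : Site 2) unitSteps) dWaveFormFactor 0) +
              (fermionEmbed (PolySite.incl hP) (localPairAt (insert (0 : Site 2) unitSteps) dWaveFormFactor 0))ᴴ))) =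
      gramForm Λm O +
        (∑ k ∈ s, (pairSourceWindowHamiltonianTT' dWaveFormFactor Λ' tp U μ h * fermionEmbed (PolySite.incl hΛ) (B k) -
            fermionEmbed (PolySite.incl hΛ) (B k) * pairSourceWindowHamiltonianTT' dWaveFormFactor Λ' tp U μ h) +
          ∑ l ∈ tt, (fermionEmbed (PolySite.incl (hsh l)) (fermionEmbed (PolySite.d4Emb (γ l) (wv l) Λ) (Y l)) -
            fermionEmbed (PolySite.incl hΛ) (Y l)) +
          ∑ j ∈ uu, b j • ladderWord (cw j)) +
        (∑ m' ∈ ah, ((dc m' : ℝ) : ℂ) • ((V m')ᴴ - V m') + ∑ k ∈ w, a k • ladderWord (word k)) +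
        kktForm (pairSourceWindowHamiltonianTT' dWaveFormFactor Λ' tp U μ h) G
          (fun b' => fermionEmbed (PolySite.incl hΛ) (Bk b')))
    (hr : ((r : ℚ) : ℝ) ≤ c - ∑ k ∈ w, ‖a k‖) :
    ∃ L₀ : ℕ, SourcedCorrLowerRowGS tp U μ h q L₀ r Λ' S Xw := by
  obtain ⟨L₁, hL₁⟩ := exists_forall_le_injOn_proj (thicken Λ' 1)
  refine ⟨max (max 3 L₁) L₀', fun L _ hInj' hL hqL => ?_⟩
  have h3 : 3 ≤ L := le_trans (le_max_left _ _) (le_trans (le_max_left _ _) hL)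
  have hL1 : L₁ ≤ L := le_trans (le_max_right _ _) (le_trans (le_max_left _ _) hL)
  exact SourcedTorusCorrLowerRowGS.of_window_certificate_kkt_of_energyUpperRow tp U μ h h3
    (hE L (le_trans (le_max_right _ _) hL) hqL) hΛ h8 h0 hz hP (hL₁ L hL1) hInj' h1 hmul hS Xw hκ hΛm O s B tt γ
    hγS wv hsh Y uu b cw hcw ah dc V w a word hG Bk hcert hr

/-- **ENERGY window identity with a KKT block ⇒ the uniform energy FLOOR cell** `∃ L₀, SourcedEnergyLowerRow tp U μ
h q L₀ e` for `e ≤ c − Σₖ ‖aₖ‖` (every side progression `q`) — the sourced `e_lo(h)` row of the Hellmann–Feynman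
chords (`Observables/PinningFieldChords`) with ground-state rows admitted. -/
theorem SourcedEnergyLowerRow.of_window_certificate_kkt (tp U μ h : ℝ) {e : ℚ} (q : ℕ)
    {Λ Λ' : Finset (Site 2)} (hΛ : Λ ⊆ Λ') (h8 : thicken Λ 1 ⊆ Λ')
    (h0 : thicken ({0} : Finset (Site 2)) 1 ⊆ Λ') (hz : (0 : Site 2) ∈ Λ')
    (hP : pairRegion (insert (0 : Site 2) unitSteps) 0 ⊆ Λ')
    {m : Type*} [Fintype m] [DecidableEq m] {Λm : Matrix m m ℂ} (hΛm : Λm.PosSemidef)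
    (O : m → FermionOp Λ')
    {κ : Type*} (s : Finset κ) (B : κ → FermionOp Λ)
    {ι : Type*} (tt : Finset ι) (gam : ι → DihedralGroup 4) (v : ι → Site 2)
    (hgam : ∀ l ∈ tt, b1gChar (gam l) = 1) (hsh : ∀ l, d4ShiftSet (gam l) (v l) Λ ⊆ Λ') (Y : ι → FermionOp Λ)
    {χ : Type*} (u : Finset χ) (b : χ → ℂ) (cw : χ → List (Orb (PolySite Λ') × Bool))
    (hcw : ∀ j ∈ u, ladderSpinCharge (cw j) ≠ 0)
    {δ : Type*} (ah : Finset δ) (dc : δ → ℝ) (V : δ → FermionOp Λ')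
    {κ'' : Type*} (w : Finset κ'') (a : κ'' → ℂ) (word : κ'' → List (Orb (PolySite Λ') × Bool))
    {β : Type*} [Fintype β] [DecidableEq β] {G : Matrix β β ℂ} (hG : G.PosSemidef)
    (Bk : β → FermionOp Λ) {c : ℝ}
    (hcert : fermionEmbed (PolySite.incl h0) ((hubbardTTPrimeFermionInteraction 1 tp U).meanEnergyObs 1) -
          (μ : ℂ) • ∑ σ : Fin 2, nAt 0 hz σ -
          (h : ℂ) • (fermionEmbed (PolySite.incl hP) (localPairAt (insert (0 : Site 2) unitSteps) dWaveFormFactor 0) +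
            (fermionEmbed (PolySite.incl hP) (localPairAt (insert (0 : Site 2) unitSteps) dWaveFormFactor 0))ᴴ) -
        (c : ℂ) • (1 : FermionOp Λ') =
      gramForm Λm O +
        (∑ k ∈ s, (pairSourceWindowHamiltonianTT' dWaveFormFactor Λ' tp U μ h * fermionEmbed (PolySite.incl hΛ) (B k) -
            fermionEmbed (PolySite.incl hΛ) (B k) * pairSourceWindowHamiltonianTT' dWaveFormFactor Λ' tp U μ h) +
          ∑ l ∈ tt, (fermionEmbed (PolySite.incl (hsh l)) (fermionEmbed (PolySite.d4Emb (gam l) (v l) Λ) (Y l)) -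
            fermionEmbed (PolySite.incl hΛ) (Y l)) +
          ∑ j ∈ u, b j • ladderWord (cw j)) +
        (∑ m' ∈ ah, ((dc m' : ℝ) : ℂ) • ((V m')ᴴ - V m') + ∑ k ∈ w, a k • ladderWord (word k)) +
        kktForm (pairSourceWindowHamiltonianTT' dWaveFormFactor Λ' tp U μ h) G
          (fun b' => fermionEmbed (PolySite.incl hΛ) (Bk b')))
    (he : ((e : ℚ) : ℝ) ≤ c - ∑ k ∈ w, ‖a k‖) :
    ∃ L₀ : ℕ, SourcedEnergyLowerRow tp U μ h q L₀ e := by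
  obtain ⟨L₀, hL₀⟩ := dWaveSourceTorusTT'_groundEnergy_ge_of_window_certificate_d4_kkt_eventually tp U μ h hΛ h8 h0
    hz hP hΛm O s B tt gam v hgam hsh Y u b cw hcw ah dc V w a word hG Bk hcert
  exact ⟨L₀, SourcedEnergyLowerRow.of_certificate_shape_TT' he hL₀⟩

end Uniform

end Summit.Ventures.CertifiedManyBodySolver

end
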